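import Summits.ValiantsHypothesis.ValiantsHypothesis.Theorems.GrenetZeonDualUnipotentThreeHalvesLongMassBipartiteGraftRungs
import Summits.ValiantsHypothesis.ValiantsHypothesis.Theorems.GrenetZeonDualUnipotentThreeHalvesLongMassBipartiteGraftInv

/-!
# `GrenetZeon.DualUnipotentThreeHalves` (stmt-ValiantsHypothesis-24318), stub (c) `SlowCore.LongMassSlowLawInv` —
# the GRAFT SPECIES IS INHABITED BY NAME: an explicit affine, nilpotent, `IrreducibleInv` pencil realising the FULL graft space over `𝔫_k`,
# priced `≤ 2⌊√n⌋k + 2n + 1`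

leafhand-val-grenetzeon-2 gen28 (29th hand), 2026-09-01; closes the by-name circle of ✓ `…BipartiteGraft` (p843376/p843382),
✓ `…BipartiteGraftPrice` (p843398), ✓ `…BipartiteGraftRungs` (p843404), ✓ `…BipartiteGraftInv` (p843410).

`exists_graft_pencil`: for all `n k m` with `2k + 1 ≤ n` and every identification `e : Fin k ⊕ (Fin k ⊕ Fin k) ≃ Fin m` there is an affine pencil
`G : AffMat n m` (coordinates: `T ↦ x_{(i,j)}`, `i,j < k`; `N ↦ x_{(i,k+j)}`, `i < j`; `s ↦ x_{(2k,2k)}`) with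
`IsAffine G`, `G ^ (2k+1) = 0`, ✓ `SlowCore.IrreducibleInv G`, ✓ `SlowCore.RelCert n m G (2(⌊√n⌋k) + 2n + 1)`, and whose VALUE SET is the
whole graft space over `𝔫_k`: every `reindex e e (graft(T, N, s))` with `N` strictly upper triangular is a value `G(x)`.  By the matrix-level
✓ `graft_inj` (dim `k² + C(k,2) + 1 ≈ b²/6`) and ✓ `graft_pow_ne_zero` (index `2k−1`) this value space is FAT and LONG; by ✓ `graft_irreducible`
it is irreducible.  So the (c)-menu has an inhabited fat ∧ long ∧ wild species on which (c) HOLDS at constant `2 + o(1)` — consistent with (c),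
not a violator; the violator portrait's new line (fast directions must be fat at every order) is what it fails.

Honest framing.  Helper (`--supports stmt-ValiantsHypothesis-24318`); nothing here proves (c), S3, 24318, 8062 or `VP ≠ VNP` — all OPEN / NOT
proved.  No definitions (the pencil is a term inside the proof), no sorry, standard axioms.
-/

set_option linter.dupNamespace false
set_option autoImplicit false

namespace Summit.ValiantsHypothesis.ValiantsHypothesis.Theorems.GrenetZeon.BipartiteGraft

open MvPolynomial Matrix
open scoped BigOperators
open Summit.ValiantsHypothesis.ValiantsHypothesis.Cruxes.TwoDimCoefficients.DimTwoCases (AffMat IsAffine)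
open Summit.ValiantsHypothesis.ValiantsHypothesis.Theorems.GrenetZeon.SlowCore (RelCert IrreducibleInv)

/-- A strictly upper triangular `k × k` matrix over a commutative semiring: `(N^L) i j = 0` whenever `j < i + L`. [folklore] -/
theorem pow_apply_eq_zero_of_strictUpper {R : Type*} [CommSemiring R] {k : ℕ} (N : Matrix (Fin k) (Fin k) R)
    (hN : ∀ i j : Fin k, (j : ℕ) ≤ i → N i j = 0) :
    ∀ (L : ℕ) (i j : Fin k), (j : ℕ) < i + L → (N ^ L) i j = 0
  | 0, i, j, hij => by
      rw [pow_zero, Matrix.one_apply, if_neg]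
      intro h
      rw [h] at hij
      omega
  | L + 1, i, j, hij => by
      rw [pow_succ, Matrix.mul_apply]
      refine Finset.sum_eq_zero fun q _ => ?_
      by_cases hq : (q : ℕ) < i + L
      · rw [pow_apply_eq_zero_of_strictUpper N hN L i q hq, zero_mul]
      · rw [hN q j (by omega), mul_zero]

/-- A strictly upper triangular `k × k` matrix satisfies `N^k = 0`. [folklore] -/
theorem pow_eq_zero_of_strictUpper {R : Type*} [CommSemiring R] {k : ℕ} (N : Matrix (Fin k) (Fin k) R)
    (hN : ∀ i j : Fin k, (j : ℕ) ≤ i → N i j = 0) : N ^ k = 0 := by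
  ext i j
  rw [Matrix.zero_apply]
  exact pow_apply_eq_zero_of_strictUpper N hN k i j (by omega)

/-- ★★ **THE GRAFT SPECIES IS INHABITED, BY NAME.**  For `2k + 1 ≤ n` and any identification `e`, an explicit affine pencil `G : AffMat n m` with
`IsAffine G`, `G^(2k+1) = 0`, `IrreducibleInv G`, `RelCert n m G (2(⌊√n⌋k) + 2n + 1)`, whose values exhaust the graft space over `𝔫_k`. -/
theorem exists_graft_pencil (n k m : ℕ) (e : Fin k ⊕ (Fin k ⊕ Fin k) ≃ Fin m) (hn : 2 * k + 1 ≤ n) :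
    ∃ G : AffMat n m, IsAffine G ∧ G ^ (2 * k + 1) = 0 ∧ IrreducibleInv G ∧
      RelCert n m G (2 * (Nat.sqrt n * k) + 2 * n + 1) ∧
      ∀ (T N : Matrix (Fin k) (Fin k) ℂ) (s : ℂ), (∀ i j : Fin k, (j : ℕ) ≤ i → N i j = 0) →
        ∃ x : Fin n × Fin n → ℂ, G.map (MvPolynomial.eval x) =
          Matrix.reindex e e (fromBlocks 0 (fromCols (s • (1 : Matrix (Fin k) (Fin k) ℂ)) (T + N))
            (fromRows T (-(s • (1 : Matrix (Fin k) (Fin k) ℂ)))) 0) := by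
  classical
  -- coordinates
  let ι₁ : Fin k → Fin n := fun i => ⟨i, by omega⟩
  let ι₂ : Fin k → Fin n := fun j => ⟨k + j, by omega⟩
  let c₀ : Fin n := ⟨2 * k, by omega⟩
  let Tp : AffMat n k := fun i j => X (ι₁ i, ι₁ j)
  let Np : AffMat n k := fun i j => if (i : ℕ) < j then X (ι₁ i, ι₂ j) else 0
  let sp : MvPolynomial (Fin n × Fin n) ℂ := X (c₀, c₀)
  have hT : IsAffine Tp := fun i j => by
    show (X (ι₁ i, ι₁ j) : MvPolynomial (Fin n × Fin n) ℂ).totalDegree ≤ 1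
    rw [totalDegree_X]
  have hNa : IsAffine Np := fun i j => by
    show ((if (i : ℕ) < j then X (ι₁ i, ι₂ j) else 0 : MvPolynomial (Fin n × Fin n) ℂ)).totalDegree ≤ 1
    split_ifs
    · rw [totalDegree_X]
    · rw [totalDegree_zero]; exact Nat.zero_le _
  have hs : sp.totalDegree ≤ 1 := by
    show (X (c₀, c₀) : MvPolynomial (Fin n × Fin n) ℂ).totalDegree ≤ 1
    rw [totalDegree_X]
  have hNtri : ∀ i j : Fin k, (j : ℕ) ≤ i → Np i j = 0 := fun i j hij => by
    show (if (i : ℕ) < j then X (ι₁ i, ι₂ j) else 0 : MvPolynomial (Fin n × Fin n) ℂ) = 0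
    rw [if_neg (by omega)]
  have hNk : Np ^ k = 0 := pow_eq_zero_of_strictUpper Np hNtri
  have htri : ∀ i j : Fin k, j ≤ i →
      (((1 : (Matrix (Fin k) (Fin k) ℂ)ˣ) : Matrix (Fin k) (Fin k) ℂ).map C * Np *
        (↑(1 : (Matrix (Fin k) (Fin k) ℂ)ˣ)⁻¹ : Matrix (Fin k) (Fin k) ℂ).map C : AffMat n k) i j = 0 := by
    intro i j hij
    rw [inv_one, Units.val_one, Matrix.map_one _ C_0 C_1, Matrix.one_mul, Matrix.mul_one]
    exact hNtri i j (by exact_mod_cast hij)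
  -- values: evaluation points realising `(T, N, s)`
  have hval : ∀ (T N : Matrix (Fin k) (Fin k) ℂ) (s : ℂ), (∀ i j : Fin k, (j : ℕ) ≤ i → N i j = 0) →
      ∃ x : Fin n × Fin n → ℂ, Tp.map (MvPolynomial.eval x) = T ∧ Np.map (MvPolynomial.eval x) = N ∧
        MvPolynomial.eval x sp = s := by
    intro T N s hN
    refine ⟨fun ab => if h : (ab.1 : ℕ) < k ∧ (ab.2 : ℕ) < k then T ⟨ab.1, h.1⟩ ⟨ab.2, h.2⟩
        else if h' : (ab.1 : ℕ) < k ∧ k ≤ (ab.2 : ℕ) ∧ (ab.2 : ℕ) < 2 * k then N ⟨ab.1, h'.1⟩ ⟨(ab.2 : ℕ) - k, by omega⟩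
        else if (ab.1 : ℕ) = 2 * k ∧ (ab.2 : ℕ) = 2 * k then s else 0, ?_, ?_, ?_⟩
    · ext i j
      rw [Matrix.map_apply]
      show MvPolynomial.eval _ (X (ι₁ i, ι₁ j)) = T i j
      rw [eval_X]
      simp only [ι₁]
      rw [dif_pos ⟨i.2, j.2⟩]
    · ext i j
      rw [Matrix.map_apply]
      show MvPolynomial.eval _ (if (i : ℕ) < j then X (ι₁ i, ι₂ j) else 0) = N i j
      split_ifs with hij
      · rw [eval_X]
        simp only [ι₁, ι₂]
        rw [dif_neg (by simp), dif_pos ⟨i.2, by omega, by omega⟩]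
        congr 1
        ext
        simp
      · rw [map_zero, hN i j (by omega)]
    · show MvPolynomial.eval _ (X (c₀, c₀)) = s
      rw [eval_X]
      simp only [c₀]
      have h1 : ¬ ((c₀ : ℕ) < k ∧ (c₀ : ℕ) < k) := by simp only [c₀]; omega
      have h2 : ¬ ((c₀ : ℕ) < k ∧ k ≤ (c₀ : ℕ) ∧ (c₀ : ℕ) < 2 * k) := by simp only [c₀]; omega
      rw [dif_neg h1, dif_neg h2]
      simp
  have hfull : ∀ (T : Matrix (Fin k) (Fin k) ℂ) (s : ℂ), ∃ x : Fin n × Fin n → ℂ,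
      Tp.map (MvPolynomial.eval x) = T ∧ Np.map (MvPolynomial.eval x) = 0 ∧ MvPolynomial.eval x sp = s :=
    fun T s => hval T 0 s (fun _ _ _ => rfl)
  -- the pencil
  refine ⟨Matrix.reindex e e (fromBlocks 0
      (fromCols (sp • (1 : Matrix (Fin k) (Fin k) (MvPolynomial (Fin n × Fin n) ℂ))) (Tp + Np))
      (fromRows Tp (-(sp • (1 : Matrix (Fin k) (Fin k) (MvPolynomial (Fin n × Fin n) ℂ))))) 0),
    isAffine_graft e Tp Np sp hT hNa hs _ rfl,
    graft_pencil_pow_eq_zero e Tp Np sp hNk le_rfl _ rfl,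
    irreducibleInv_graft hfull _ rfl,
    relCert_graft_of_triangularisable hT hNa hs 1 htri _ rfl, ?_⟩
  intro T N s hN
  obtain ⟨x, hxT, hxN, hxs⟩ := hval T N s hN
  refine ⟨x, ?_⟩
  rw [Matrix.reindex_apply, ← Matrix.submatrix_map, graft_map_eval, hxT, hxN, hxs, ← Matrix.reindex_apply]

end Summit.ValiantsHypothesis.ValiantsHypothesis.Theorems.GrenetZeon.BipartiteGraft
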